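import Literature.LinearAlgebra.Matrix.PolynomialMatrixRankLoci
import Literature.LinearAlgebra.Matrix.RankNormalForm
import HarnessLib

/-!
# How many members of a matrix pencil `A + tB` drop rank: at most `rank A + rank B − (number of rows)`

Topic `Literature/LinearAlgebra/Matrix`; namespace `Literature.LinearAlgebra.Matrix`. Let `F` be a field and
`A, B ∈ Mat_{m×n}(F)`; the pencil `t ↦ A + tB` is the specialisation of the polynomial matrix
`A + X·B ∈ Mat_{m×n}(F[X])` (`pencil_map_eval`).

**The printed statement.** R. Kloosterman, *On a conjecture on Hodge loci of linear combinations of linear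
subvarieties*, Rend. Circ. Mat. Palermo (2) (2025) = arXiv:2312.12363, §2.3 'Bilinear maps' (pairings
`φ₁, φ₂ : V × W → ℂ`, `r_i = rank φ_i`) proves the count in two steps [cite: Kloosterman2025, Lemma 2.6]:
"suppose `s₁ = dim V − r₁` holds, i.e., `ker_L φ₂|_{V₁×W₁} = 0`, then for at most `dim V − s₁ − s₂` nonzero values
of `t` we have the strict inequality `rank φ₁+tφ₂ < dim V`" (base case of the printed induction: "Pick bases for
`V` and `W`. Let `A_i` be the Gram matrix of `φ_i`. The values of `t` for which the rank of `A₁+tA₂` is less than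
`dim V` are precisely the common zeros of all maximal minors of `A₁+tA₂`, which are polynomials in `t` of degree
at most `dim V`. Since the maximal rank is `dim V` there is at least one such a minor which is nonzero … Therefore
there are at most `dim V` common zeroes of these maximal minors."), and then, in the proof of
[cite: Kloosterman2025, Thm. 3.13]: "From Lemma (lemSpectrumSize) it follows that for at most `dim V−s₁−s₂`
nonzero values of `λ` there is a rank drop. In our case … `s_i = dim V − r_j`. This implies that there are at most
`r₁+r₂−dim V` exceptional values. By construction `r_j = h_{I_j}(d)` and `dim V = h_{I₁∩I₂}(d)`. Using Lemma
(lemHP) we obtain `r₁+r₂−dim V = h_{I₁+I₂}(d)`." — which is the second assertion of Thm. 3.13: "there are at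
most `h_{I₁+I₂}(d)` values of `λ ∈ ℚ*` such that `codim T_X NL([Y₁]+λ[Y₂]) < codim T_X NL([Y₁],[Y₂])`".

**What this file proves** (`ncard_pencil_rank_lt_add_card_le`, sorry-free, any field): if ONE member
`A + t₀B` has full row rank `|m|`, then the number of NONZERO `t ∈ F` with `rank(A + tB) < |m|` is at most
`rank A + rank B − |m|` (stated additively: `#{t ≠ 0 : rank(A+tB) < |m|} + |m| ≤ rank A + rank B`). This is the
printed conclusion "at most `r₁+r₂−dim V` exceptional values" under the sole hypothesis that the pencil has
full left rank somewhere (in print this is guaranteed by Lemma 2.5 from `s₁ = dim V − r₁`; over `ℂ` it is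
equivalent to 'for all but finitely many `t`'). Our proof sharpens the printed base-case argument by keeping
track of the order and the degree of the controlling maximal minor instead of running the printed induction on
`s₁, s₂`: a maximal minor `q(X) = det((A + X·B)[:,C])` non-vanishing at `t₀`
(`exists_minor_controls_rank`, file `PolynomialMatrixRankLoci.lean`) satisfies
`X^{|m| − rank A[:,C]} ∣ q` (`X_pow_dvd_det_pencil`: bring `A[:,C]` to rank normal form `P E_r Q` by a strict
equivalence of the pencil, [cite: Gantmacher1984, Vol. 2 Ch. XII §1.2], file `RankNormalForm.lean`; the
`|m| − r` columns of `E_r + X·B'` outside the idempotent are divisible by `X`) and `deg q ≤ rank B[:,C]`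
(`natDegree_det_pencil_le_rank`: normal form of `B[:,C]` instead; only `rank` columns carry an `X`); a non-zero
polynomial with `X^a ∣ q`, `deg q ≤ b` has at most `b − a` NONZERO roots (`ncard_nonzero_roots_add_le`). Hence
`#{t ≠ 0 : rank drop} ≤ rank B[:,C] − (|m| − rank A[:,C]) ≤ rank A + rank B − |m|`.

Also: `natDegree_det_le_sum_col` / `pow_dvd_det_of_forall_dvd` (Leibniz expansion with column-wise degree /
divisibility bounds), the column form `ncard_pencil_rank_lt_card_width_add_le` (transpose), the truncated
form `ncard_pencil_rank_lt_le`, and the GENERAL form `ncard_pencil_rank_lt_add_le` / `ncard_pencil_rank_lt_le_sub`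
(drops below any certified rank `s ≤ rank(A + t₀B)`: `#{t ≠ 0 : rank(A+tB) < s} + s ≤ rank A + rank B`, same
proof with `s × s` minors — it also counts the parameters where the rank drops below its generic value). The pairing (Gram-matrix) form used by [cite: Kloosterman2025, Lemma 3.12,
Thm. 3.13] — `#{c ≠ 0 : ker_L(φ₁ + cφ₂) ≠ 0} ≤ r₁ + r₂ − dim V` — is derived from this file in
`Literature/AlgebraicGeometry/Kloosterman2025/`.

Use (Hodge-locus census, cell `pub-hlocus`, the 'λ-jump' rows of the Aoki–Shioda table): with
`e(λ) = dim ker_L(ψ₁ + ν(λ)ψ₂)` [cite: Kloosterman2025, Lemma 3.12] the number of `λ ∈ ℚ*` with `e(λ) > e_gen = 0`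
is at most `H = h_{I₁+I₂}(kd−2k−2)` once ONE `λ` with `e(λ) = 0` is certified — a sharper exceptional-set bound
than the degree count `|m|·D` of `ncard_setOf_rank_map_eval_lt_le`.
-/

noncomputable section

namespace Literature.LinearAlgebra.Matrix

open _root_.Matrix _root_.Polynomial Finset

/-! ### Leibniz expansion with column-wise bounds -/

section Leibniz

variable {S : Type*} [CommRing S] {ι : Type*} [Fintype ι] [DecidableEq ι]

/-- Degree of a determinant with column-wise degree bounds: if every entry of column `j` of
`M ∈ Mat(S[X])` has degree `≤ d j`, then `deg det M ≤ Σ_j d j` (Leibniz expansion). [folklore] -/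
private theorem natDegree_det_le_sum_col (M : Matrix ι ι S[X]) (d : ι → ℕ)
    (h : ∀ i j, (M i j).natDegree ≤ d j) : M.det.natDegree ≤ ∑ j, d j := by
  rw [Matrix.det_apply]
  refine natDegree_sum_le_of_forall_le _ _ fun σ _ ↦ ?_
  have hprod : (∏ i, M (σ i) i).natDegree ≤ ∑ j, d j :=
    (natDegree_prod_le _ _).trans (sum_le_sum fun i _ ↦ h (σ i) i)
  rcases Int.units_eq_one_or (Equiv.Perm.sign σ) with hσ | hσ
  · rw [hσ, one_smul]; exact hprod
  · rw [hσ, Units.neg_smul, one_smul, natDegree_neg]; exact hprod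

/-- Divisibility of a determinant with column-wise divisibility: if every entry of column `j` of `M` is
divisible by `x ^ e j`, then `x ^ (Σ_j e j) ∣ det M` (Leibniz expansion). [folklore] -/
private theorem pow_dvd_det_of_forall_dvd (M : Matrix ι ι S) (x : S) (e : ι → ℕ)
    (h : ∀ i j, x ^ e j ∣ M i j) : x ^ (∑ j, e j) ∣ M.det := by
  rw [Matrix.det_apply]
  refine dvd_sum fun σ _ ↦ ?_
  have hprod : x ^ (∑ j, e j) ∣ ∏ i, M (σ i) i := by
    rw [← prod_pow_eq_pow_sum]
    exact prod_dvd_prod_of_dvd _ _ fun i _ ↦ h (σ i) i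
  rcases Int.units_eq_one_or (Equiv.Perm.sign σ) with hσ | hσ
  · rw [hσ, one_smul]; exact hprod
  · rw [hσ, Units.neg_smul, one_smul]; exact (dvd_neg).mpr hprod

end Leibniz

/-! ### The pencil `A + X·B` and its specialisations -/

section Pencil

variable {F : Type*} [Field F] {m n : Type*} [Fintype m] [Fintype n]

omit [Fintype m] [Fintype n] in
/-- Specialising the polynomial matrix `A + X·B` at `t` gives the pencil member `A + tB`. [folklore] -/
private theorem pencil_map_eval (A B : Matrix m n F) (t : F) :
    (A.map C + (X : F[X]) • B.map C).map (eval t) = A + t • B := by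
  ext i j
  simp only [Matrix.map_apply, Matrix.add_apply, Matrix.smul_apply, smul_eq_mul, eval_add, eval_mul,
    eval_C, eval_X]

omit [Fintype m] [Fintype n] in
/-- Minors of the pencil are pencils of the minors. [folklore] -/
private theorem pencil_submatrix {ι κ : Type*} (A B : Matrix m n F) (r : ι → m) (c : κ → n) :
    (A.map C + (X : F[X]) • B.map C).submatrix r c =
      (A.submatrix r c).map C + (X : F[X]) • (B.submatrix r c).map C := rfl

/-- Counting the two halves of `Fin s` cut at `r ≤ s`. [folklore] -/
private theorem sum_ite_lt_eq {s r : ℕ} (hr : r ≤ s) : ∑ j : Fin s, (if (j : ℕ) < r then 1 else 0) = r := by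
  rw [Finset.sum_boole, Nat.cast_id, ← Fintype.card_subtype]
  exact Fintype.card_fin_lt_of_le hr

/-- Counting the two halves of `Fin s` cut at `r ≤ s` (complement). [folklore] -/
private theorem sum_ite_lt_eq' {s r : ℕ} (hr : r ≤ s) : ∑ j : Fin s, (if (j : ℕ) < r then 0 else 1) = s - r := by
  have htot : ∑ j : Fin s, ((if (j : ℕ) < r then 0 else 1) + (if (j : ℕ) < r then 1 else 0)) = s := by
    rw [Finset.sum_congr rfl (g := fun _ => 1) (fun j _ => by split_ifs <;> rfl)]
    simp
  rw [sum_add_distrib, sum_ite_lt_eq hr] at htot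
  omega

/-- **Strict equivalence of a pencil** [cite: Gantmacher1984, Vol. 2 Ch. XII §1.2]: `P(A + X·B)Q` for constant
invertible `P, Q`; here in the form we use it — conjugating the polynomial matrix by `P.map C`, `Q.map C`.
[folklore] -/
theorem pencil_conj {s : ℕ} (P Q A' B' : Matrix (Fin s) (Fin s) F) :
    (P * A' * Q).map C + (X : F[X]) • (P * B' * Q).map C =
      P.map C * (A'.map C + (X : F[X]) • B'.map C) * Q.map C := by
  rw [Matrix.map_mul, Matrix.map_mul, Matrix.map_mul, Matrix.map_mul, Matrix.mul_add, Matrix.add_mul,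
    Matrix.mul_smul, Matrix.smul_mul]

omit [Fintype m] [Fintype n] in
/-- Entries of the polynomial matrix `A + X·B`. [folklore] -/
private theorem pencil_apply (A B : Matrix m n F) (i : m) (j : n) :
    (A.map C + (X : F[X]) • B.map C) i j = C (A i j) + X * C (B i j) := rfl

/-- `det (M.map C) = C (det M)` (`C : F → F[X]` is a ring morphism). [folklore] -/
private theorem det_map_C {ι : Type*} [Fintype ι] [DecidableEq ι] (M : Matrix ι ι F) :
    (M.map C).det = C M.det := by
  rw [RingHom.map_det, RingHom.mapMatrix_apply]

/-- `M = P (P⁻¹ M Q⁻¹) Q` for `P, Q ∈ GL`. [folklore] -/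
private theorem GL_conj_eq {s : ℕ} (P Q : GL (Fin s) F) (M : Matrix (Fin s) (Fin s) F) :
    M = (P : Matrix (Fin s) (Fin s) F) *
      (((P⁻¹ : GL (Fin s) F) : Matrix (Fin s) (Fin s) F) * M * ((Q⁻¹ : GL (Fin s) F) : Matrix (Fin s) (Fin s) F)) *
      (Q : Matrix (Fin s) (Fin s) F) := by
  calc M = ((P : Matrix (Fin s) (Fin s) F) * ((P⁻¹ : GL (Fin s) F) : Matrix (Fin s) (Fin s) F)) * M *
        (((Q⁻¹ : GL (Fin s) F) : Matrix (Fin s) (Fin s) F) * (Q : Matrix (Fin s) (Fin s) F)) := by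
        rw [Units.mul_inv, Units.inv_mul, Matrix.one_mul, Matrix.mul_one]
    _ = _ := by simp only [Matrix.mul_assoc]

/-- Off the first `r` columns the standard rank-`r` idempotent vanishes. [folklore] -/
private theorem rankStdMatrix_apply_of_not_lt {s r : ℕ} {i j : Fin s} (hj : ¬ (j : ℕ) < r) :
    rankStdMatrix s r F i j = 0 := by
  rw [rankStdMatrix_apply, if_neg]
  rintro ⟨hij, hi⟩
  exact hj (hij ▸ hi)

/-- **Degree of the determinant of a square pencil**: `deg det(A + X·B) ≤ rank B`. Proof: write `B = P E_r Q`
(`E_r` the standard rank-`r` idempotent, `r = rank B`, `exists_units_eq_mul_rankStdMatrix_mul`), so that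
`det(A + X·B) = det P · det(P⁻¹AQ⁻¹ + X·E_r) · det Q` and only the first `r` columns of `P⁻¹AQ⁻¹ + X·E_r`
involve `X`, each linearly. [folklore; the 'maximal minors are polynomials in `t`' step of
[cite: Kloosterman2025, Lemma 2.6 (proof)], sharpened from `≤ dim V` to `≤ rank`] -/
theorem natDegree_det_pencil_le_rank {s : ℕ} (A B : Matrix (Fin s) (Fin s) F) :
    (det (A.map C + (X : F[X]) • B.map C)).natDegree ≤ B.rank := by
  classical
  obtain ⟨P, Q, hB⟩ := exists_units_eq_mul_rankStdMatrix_mul B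
  have hrs : B.rank ≤ s := by simpa using rank_le_card_height B
  generalize B.rank = r at hB hrs ⊢
  have hA : A = (P : Matrix (Fin s) (Fin s) F) *
      (((P⁻¹ : GL (Fin s) F) : Matrix (Fin s) (Fin s) F) * A * ((Q⁻¹ : GL (Fin s) F) : Matrix (Fin s) (Fin s) F)) *
      (Q : Matrix (Fin s) (Fin s) F) := GL_conj_eq P Q A
  rw [hA, hB, pencil_conj, det_mul, det_mul, det_map_C, det_map_C]
  refine (natDegree_mul_C_le _ _).trans ((natDegree_C_mul_le _ _).trans ?_)
  -- the middle factor: column `j` has degree ≤ 1 if `j < r = rank B`, ≤ 0 otherwise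
  refine le_trans (natDegree_det_le_sum_col _ (fun j : Fin s => if (j : ℕ) < r then 1 else 0) fun i j ↦ ?_)
    (le_of_eq (sum_ite_lt_eq hrs))
  rw [pencil_apply]
  by_cases hj : (j : ℕ) < r
  · rw [if_pos hj, add_comm, X_mul_C]
    exact natDegree_linear_le
  · rw [if_neg hj, rankStdMatrix_apply_of_not_lt hj, map_zero, mul_zero, add_zero, natDegree_C]

/-- **Order of the determinant of a square pencil at `X = 0`**: `X^{s − rank A} ∣ det(A + X·B)` for
`A, B ∈ Mat_s(F)`. Proof: write `A = P E_r Q` (`r = rank A`); the last `s − r` columns of `E_r + X·(P⁻¹BQ⁻¹)`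
are divisible by `X`. [folklore; the 'zero eigenvalue of multiplicity ≥ s − rank A' half of the regular-pencil
bookkeeping, cf. [cite: Gantmacher1984, Vol. 2 Ch. XII §2]] -/
theorem X_pow_dvd_det_pencil {s : ℕ} (A B : Matrix (Fin s) (Fin s) F) :
    (X : F[X]) ^ (s - A.rank) ∣ det (A.map C + (X : F[X]) • B.map C) := by
  classical
  obtain ⟨P, Q, hA⟩ := exists_units_eq_mul_rankStdMatrix_mul A
  have hrs : A.rank ≤ s := by simpa using rank_le_card_height A
  generalize A.rank = r at hA hrs ⊢
  have hB : B = (P : Matrix (Fin s) (Fin s) F) *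
      (((P⁻¹ : GL (Fin s) F) : Matrix (Fin s) (Fin s) F) * B * ((Q⁻¹ : GL (Fin s) F) : Matrix (Fin s) (Fin s) F)) *
      (Q : Matrix (Fin s) (Fin s) F) := GL_conj_eq P Q B
  rw [hB, hA, pencil_conj, det_mul, det_mul]
  refine Dvd.dvd.mul_right (Dvd.dvd.mul_left ?_ _) _
  rw [← sum_ite_lt_eq' hrs]
  refine pow_dvd_det_of_forall_dvd _ X (fun j : Fin s => if (j : ℕ) < r then 0 else 1) fun i j ↦ ?_
  rw [pencil_apply]
  by_cases hj : (j : ℕ) < r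
  · rw [if_pos hj, pow_zero]
    exact one_dvd _
  · rw [if_neg hj, pow_one, rankStdMatrix_apply_of_not_lt hj, map_zero, zero_add]
    exact dvd_mul_right X _

/-- **Non-zero roots of a polynomial of order `≥ a` and degree `≤ b`**: a non-zero `q ∈ F[X]` with `X^a ∣ q`
and `deg q ≤ b` has at most `b − a` NON-ZERO roots, and so does any set of non-zero roots of `q`
(`q = X^a q₁`, the non-zero roots of `q` are roots of `q₁`, `deg q₁ = deg q − a`). [folklore] -/
private theorem ncard_nonzero_roots_add_le {q : F[X]} (hq : q ≠ 0) {a b : ℕ} (ha : (X : F[X]) ^ a ∣ q)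
    (hb : q.natDegree ≤ b) (T : Set F) (hT : ∀ t ∈ T, t ≠ 0 ∧ q.IsRoot t) : T.ncard + a ≤ b := by
  classical
  obtain ⟨q₁, rfl⟩ := ha
  have hq₁ : q₁ ≠ 0 := by
    rintro rfl
    exact hq (mul_zero _)
  have hdeg : (X ^ a * q₁).natDegree = a + q₁.natDegree := by
    rw [natDegree_mul (pow_ne_zero a X_ne_zero) hq₁, natDegree_X_pow]
  have hsub : T ⊆ (q₁.roots.toFinset : Set F) := by
    intro t ht
    obtain ⟨ht0, hroot⟩ := hT t ht
    have h1 : t ^ a * q₁.eval t = 0 := by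
      have h := hroot.eq_zero
      rwa [eval_mul, eval_pow, eval_X] at h
    have h2 : q₁.eval t = 0 := (mul_eq_zero.mp h1).resolve_left (pow_ne_zero a ht0)
    simp only [Finset.mem_coe, Multiset.mem_toFinset, mem_roots hq₁, IsRoot.def]
    exact h2
  calc T.ncard + a ≤ (q₁.roots.toFinset : Set F).ncard + a :=
        Nat.add_le_add_right (Set.ncard_le_ncard hsub (Finset.finite_toSet _)) a
    _ = q₁.roots.toFinset.card + a := by rw [Set.ncard_coe_finset]
    _ ≤ Multiset.card q₁.roots + a := Nat.add_le_add_right (Multiset.toFinset_card_le _) a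
    _ ≤ q₁.natDegree + a := Nat.add_le_add_right (card_roots' _) a
    _ ≤ b := by omega

/-- **At most `rank A + rank B − |m|` members of the pencil drop below full row rank.**
[cite: Kloosterman2025, Lemma 2.6, Thm. 3.13 (proof: "there are at most `r₁+r₂−dim V` exceptional values")]:
if `A + t₀B` has rank `|m|` (full row rank, i.e. no left kernel) for ONE `t₀`, then
`#{t ∈ F : t ≠ 0, rank(A + tB) < |m|} + |m| ≤ rank A + rank B`. (Over any field; in particular the hypothesis
forces `rank A + rank B ≥ |m|`.) Proof: see the module docstring (controlling maximal minor, its order at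
`X = 0` and its degree). -/
theorem ncard_pencil_rank_lt_add_card_le (A B : Matrix m n F) {t₀ : F}
    (h : Fintype.card m ≤ (A + t₀ • B).rank) :
    {t : F | t ≠ 0 ∧ (A + t • B).rank < Fintype.card m}.ncard + Fintype.card m ≤ A.rank + B.rank := by
  classical
  set Pm : Matrix m n F[X] := A.map C + (X : F[X]) • B.map C with hPm
  have hev : ∀ t, Pm.map (eval t) = A + t • B := fun t => pencil_map_eval A B t
  have h0 : Fintype.card m ≤ (Pm.map (eval t₀)).rank := by rw [hev]; exact h
  obtain ⟨r, c, hq, -, hrank⟩ := exists_minor_controls_rank Pm h0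
  -- the controlling minor is the pencil of the minors
  have hsub : Pm.submatrix r c =
      (A.submatrix r c).map C + (X : F[X]) • (B.submatrix r c).map C := by
    rw [hPm]; rfl
  rw [hsub] at hq hrank
  set A' := A.submatrix r c with hA'
  set B' := B.submatrix r c with hB'
  -- order and degree of the controlling minor
  have hord := X_pow_dvd_det_pencil A' B'
  have hdeg := natDegree_det_pencil_le_rank A' B'
  -- the exceptional parameters are non-zero roots of it
  have hT : ∀ t ∈ {t : F | t ≠ 0 ∧ (A + t • B).rank < Fintype.card m},
      t ≠ 0 ∧ (det (A'.map C + (X : F[X]) • B'.map C)).IsRoot t := by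
    rintro t ⟨ht0, hlt⟩
    refine ⟨ht0, ?_⟩
    by_contra hroot
    have := hrank t hroot
    rw [hev] at this
    exact (not_le.mpr hlt) this
  have hcount := ncard_nonzero_roots_add_le hq hord hdeg _ hT
  -- bookkeeping: `rank A' ≤ rank A`, `rank B' ≤ rank B`, `rank A' ≤ |m|`
  have hA'le : A'.rank ≤ A.rank := rank_submatrix_le A r c
  have hB'le : B'.rank ≤ B.rank := rank_submatrix_le B r c
  have hA's : A'.rank ≤ Fintype.card m := by
    simpa using rank_le_card_height A'
  omega

/-- Truncated form: under the same hypothesis, `#{t ≠ 0 : rank(A + tB) < |m|} ≤ rank A + rank B − |m|`.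
[cite: Kloosterman2025, Lemma 2.6, Thm. 3.13 (proof)] -/
theorem ncard_pencil_rank_lt_le (A B : Matrix m n F) {t₀ : F}
    (h : Fintype.card m ≤ (A + t₀ • B).rank) :
    {t : F | t ≠ 0 ∧ (A + t • B).rank < Fintype.card m}.ncard ≤ A.rank + B.rank - Fintype.card m := by
  have := ncard_pencil_rank_lt_add_card_le A B h
  omega

/-- Column form (full column rank, i.e. no right kernel): if `rank(A + t₀B) = |n|` for one `t₀`, then
`#{t ≠ 0 : rank(A + tB) < |n|} + |n| ≤ rank A + rank B` (transpose the pencil).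
[cite: Kloosterman2025, Lemma 2.6, Thm. 3.13 (proof)] -/
theorem ncard_pencil_rank_lt_card_width_add_le (A B : Matrix m n F) {t₀ : F}
    (h : Fintype.card n ≤ (A + t₀ • B).rank) :
    {t : F | t ≠ 0 ∧ (A + t • B).rank < Fintype.card n}.ncard + Fintype.card n ≤ A.rank + B.rank := by
  have hT : ∀ t : F, (Aᵀ + t • Bᵀ).rank = (A + t • B).rank := fun t => by
    rw [← transpose_smul, ← transpose_add, rank_transpose]
  have h' : Fintype.card n ≤ (Aᵀ + t₀ • Bᵀ).rank := by rw [hT]; exact h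
  have := ncard_pencil_rank_lt_add_card_le Aᵀ Bᵀ h'
  simp only [hT, rank_transpose] at this
  exact this

/-- **General form: drops below ANY certified rank.** If `s ≤ rank(A + t₀B)` for ONE `t₀`, then
`#{t ∈ F : t ≠ 0, rank(A + tB) < s} + s ≤ rank A + rank B` — the same argument run with `s × s` minors
(`ncard_pencil_rank_lt_add_card_le` is the case `s = |m|`, which is the printed one: in
[cite: Kloosterman2025, Lemma 2.6, Thm. 3.13 (proof)] `s = dim V`, i.e. full left rank / generic excess `0`).
This form also bounds the number of parameters at which the rank drops below its GENERIC value `s` (e.g. the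
`λ`-jumps `e(λ) > e_gen` of a pencil whose generic excess `e_gen` is positive): they are at most
`rank A + rank B − s` in number. -/
theorem ncard_pencil_rank_lt_add_le (A B : Matrix m n F) {s : ℕ} {t₀ : F} (h : s ≤ (A + t₀ • B).rank) :
    {t : F | t ≠ 0 ∧ (A + t • B).rank < s}.ncard + s ≤ A.rank + B.rank := by
  classical
  set Pm : Matrix m n F[X] := A.map C + (X : F[X]) • B.map C with hPm
  have hev : ∀ t, Pm.map (eval t) = A + t • B := fun t => pencil_map_eval A B t
  have h0 : s ≤ (Pm.map (eval t₀)).rank := by rw [hev]; exact h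
  obtain ⟨r, c, hq, -, hrank⟩ := exists_minor_controls_rank Pm h0
  have hsub : Pm.submatrix r c =
      (A.submatrix r c).map C + (X : F[X]) • (B.submatrix r c).map C := by
    rw [hPm]; rfl
  rw [hsub] at hq hrank
  set A' := A.submatrix r c with hA'
  set B' := B.submatrix r c with hB'
  have hord := X_pow_dvd_det_pencil A' B'
  have hdeg := natDegree_det_pencil_le_rank A' B'
  have hT : ∀ t ∈ {t : F | t ≠ 0 ∧ (A + t • B).rank < s},
      t ≠ 0 ∧ (det (A'.map C + (X : F[X]) • B'.map C)).IsRoot t := by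
    rintro t ⟨ht0, hlt⟩
    refine ⟨ht0, ?_⟩
    by_contra hroot
    have := hrank t hroot
    rw [hev] at this
    exact (not_le.mpr hlt) this
  have hcount := ncard_nonzero_roots_add_le hq hord hdeg _ hT
  have hA'le : A'.rank ≤ A.rank := rank_submatrix_le A r c
  have hB'le : B'.rank ≤ B.rank := rank_submatrix_le B r c
  have hA's : A'.rank ≤ s := by
    simpa using rank_le_card_height A'
  omega

/-- Truncated form of `ncard_pencil_rank_lt_add_le`: `#{t ≠ 0 : rank(A + tB) < s} ≤ rank A + rank B − s`
whenever `s ≤ rank(A + t₀B)` for one `t₀`. [cite: Kloosterman2025, Lemma 2.6, Thm. 3.13 (proof)] -/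
theorem ncard_pencil_rank_lt_le_sub (A B : Matrix m n F) {s : ℕ} {t₀ : F} (h : s ≤ (A + t₀ • B).rank) :
    {t : F | t ≠ 0 ∧ (A + t • B).rank < s}.ncard ≤ A.rank + B.rank - s := by
  have := ncard_pencil_rank_lt_add_le A B h
  omega

/-! ### Finiteness of the exceptional set (so that the `ncard` bounds above are bounds on an honest finite
cardinality: `Set.ncard` of an infinite set is `0` by convention) -/

/-- **The exceptional set is finite.** If `s ≤ rank(A + t₀B)` for one `t₀`, then `{t : rank(A + tB) < s}` is a
finite set (lower semicontinuity of rank in the algebraic family `A + X·B`, i.e.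
`setOf_rank_map_eval_lt_finite` of `PolynomialMatrixRankLoci.lean` applied to the pencil); in particular the
sets counted by `ncard_pencil_rank_lt_add_le` and `ncard_pencil_rank_lt_add_card_le` are finite and their
`Set.ncard` is their cardinality. [cite: Kloosterman2025, Lemma 2.6, Thm. 3.13 ("for all but finitely many λ")] -/
theorem setOf_pencil_rank_lt_finite (A B : Matrix m n F) {s : ℕ} {t₀ : F} (h : s ≤ (A + t₀ • B).rank) :
    {t : F | (A + t • B).rank < s}.Finite := by
  have h0 : s ≤ ((A.map C + (X : F[X]) • B.map C).map (eval t₀)).rank := by rw [pencil_map_eval]; exact h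
  have hfin := setOf_rank_map_eval_lt_finite (A.map C + (X : F[X]) • B.map C) h0
  refine hfin.subset ?_
  intro t ht
  simp only [Set.mem_setOf_eq] at ht ⊢
  rw [pencil_map_eval]
  exact ht

/-- The set of NON-ZERO exceptional parameters is finite as well, so `ncard_pencil_rank_lt_add_le` reads: there are
at most `rank A + rank B − s` non-zero `t` with `rank(A + tB) < s`, as an honest cardinality.
[cite: Kloosterman2025, Lemma 2.6, Thm. 3.13 (proof)] -/
theorem setOf_pencil_rank_lt_finite' (A B : Matrix m n F) {s : ℕ} {t₀ : F} (h : s ≤ (A + t₀ • B).rank) :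
    {t : F | t ≠ 0 ∧ (A + t • B).rank < s}.Finite :=
  (setOf_pencil_rank_lt_finite A B h).subset fun _ ht => ht.2

/-- Finite-cardinality form of the general count: with `T` the FINSET of non-zero `t` with `rank(A + tB) < s`
(any finset of such parameters), `T.card + s ≤ rank A + rank B`. [cite: Kloosterman2025, Lemma 2.6, Thm. 3.13 (proof)] -/
theorem card_finset_pencil_rank_lt_add_le (A B : Matrix m n F) {s : ℕ} {t₀ : F} (h : s ≤ (A + t₀ • B).rank)
    (T : Finset F) (hT : ∀ t ∈ T, t ≠ 0 ∧ (A + t • B).rank < s) : T.card + s ≤ A.rank + B.rank := by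
  have hsub : (T : Set F) ⊆ {t : F | t ≠ 0 ∧ (A + t • B).rank < s} := fun t ht => hT t ht
  have hle := Set.ncard_le_ncard hsub (setOf_pencil_rank_lt_finite' A B h)
  rw [Set.ncard_coe_finset] at hle
  have := ncard_pencil_rank_lt_add_le A B h
  omega

end Pencil

end Literature.LinearAlgebra.Matrix
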